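import Literature.IUT.HodgeTheaters.TemperedCoveringsCor23LevelsGraph
import Literature.IUT.HodgeTheaters.TemperedCoveringsFreeModelLevelDataCapstone
import Literature.AnabelianGeometry.SemiGraphs.SubdivisionLemmas
import HarnessLib

/-!
# Non-vacuity of `Prop24Tower.CoveringLevelGraphs`: the Schreier coverings of the bouquet at the free-group toy

Mochizuki, *Inter-universal Teichmüller theory I*, kurims manuscript (May 2020), §2, Prop. 2.4 (i) p. 50
l. 27–30 (the levels `𝔾_J` "associated to the special fiber of the stable model … of the finite étale covering
… determined by `J`") and Cor. 2.3 pp. 47–49 ([IUTchI] Prop 2.4(i) p.50) [claim: Mochizuki2012, status: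
disputed] (D-0012 claim key; nothing of the series is asserted here); the semi-graph combinatorics is
[SemiAnbd] §1 pp. 11–13 (Mochizuki, *Semi-graphs of anabelioids*, Publ. RIMS 42 (2006))
[cite: MochizukiSemiAnbd2006, §1 pp.11-13].

PROOF-ONLY non-vacuity file (abc-iut cell, NV-L5; row `Prop24Tower.CoveringLevelGraphs` of the L5
inhabitation census, a ZERO-producer record until now; seat abc-iut-w4-d076, the author of the record
`CoveringLevelGraphs` in `TemperedCoveringsCor23LevelsGraph.lean`).  No `def`, no `instance`, no notation:
every witness is built inside a theorem.  HONEST LABELS (cell rule): `_degenerate` = type-inhabitation only;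
`_model` = the genuine object of abc-iut-L5-d4's toy datum `StableCurveTemperedData.FreeModel.toy`
(`Π^tp_X = Δ^tp_X = Π^tp_𝔾 = F₂ = π₁` of the bouquet `B₂` of two loops `x₀, x₁`, `G_k = 1`, no cusps,
`ℍ` = the `x₀`-loop; curve level = graph level).

* § 0  Two general [SemiAnbd] §1 lemmas on the barycentric subdivision of a sub-semi-graph: two vertices of a
  sub-semi-graph joined by one of ITS edges are in the same connected component
  (`Subgraph.reachable_inl_inl_of_edge`), and a vertex predicate that is balanced along every edge of the
  sub-semi-graph is constant on connected components (`Subgraph.reachable_inl_inl_invariant`).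
* § 1  `CoveringLevelGraphs.nonempty_degenerate`: over EVERY tower of EVERY datum the record is inhabited
  (one-vertex edgeless semi-graphs, identity projections, trivial deck action).  Type-inhabitation only.
* § 2  `_model` at the toy (`FreeModel.CoveringLevelGraphs.exists_model_free`): for EVERY tower `T` of the toy
  with normal levels (`T.LevelsNormal`, "characteristic", p. 50 l. 27), the SEMI-GRAPH-COVERING realisation:
  base = the bouquet `B₂` as a `SemiGraph` (one vertex, two loops), `ℍ` = the `x₀`-loop, level `i` = the
  SCHREIER COSET GRAPH of `F₂ ⧸ J_i` (`J_i := ι⁻¹(Ĵ_i) ⊴ F₂`; vertices the cosets, an `x_s`-edge from `v` to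
  `v·x_s`) — which IS the finite étale covering of `B₂` determined by `J_i` — with its covering projection
  `p_i`, `Π^tp_X = F₂` acting by LEFT translation = deck transformations (the law `act_over` holds), `c_i` = the
  coset of `1`.  For the level data `C.toLevelData` REALISED by it (abc-iut-w4-d076's `toLevelData`: components
  of `p_i⁻¹(ℍ)` = reachability classes of the subdivision) ALL named rows of abc-iut-L5-t11's carrier hold:
  B4 `CompsDisjoint` / `CompsInvariant` / `IsBlock` as INSTANCES of the general theorems of
  `TemperedCoveringsCor23LevelsGraph.lean`, B1 (a) `LevelActsTrivially` (`J_i ⊴ F₂` acts trivially on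
  `F₂ ⧸ J_i`), and — the component `ℍ̃_i` through `c_i` being COMPUTED as the `x₀`-Schreier class `{x₀^k·J_i}_k`
  (`§ 0` lemmas) — B1 (b) `DeltaHStabilizes`, (c) `StabLeDeltaHLevel` (`Stab_{F₂}(ℍ̃_i) = ⟨x₀⟩·J_i`); the
  cusp-indexed `LevelIncidence` / `LevelTarget` hold VACUOUSLY (no cusps).  Its vertex sets `F₂ ⧸ J_i` are those
  of abc-iut-w4-d063's hand-made `SubgraphLevelData.exists_model_free` (consistency of the two encodings).
* § 3  Capstone `FreeModel.exists_prop24Tower_coveringLevelGraphs_model`: abc-iut-w4-d012's tower of ALL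
  finite-index normal subgroups of `F₂` (its ten Prop. 2.4 (i) laws, `exists_prop24Tower_model`) carries this
  realisation.

What this file is NOT: not the arithmetic situation of p. 50 (there `G_k` moves `𝔾` and only the geometric
`Δ^tp_X` acts over `p_i` — abc-iut-w4-d063's note; at the toy `G_k = 1`), and not a statement that any curve
carries such data.  Nothing here bears on [IUTchIII] Cor. 3.12; instantiated ≠ endorsed; no side taken.
-/

namespace Literature.AnabelianGeometry.SemiGraphs

namespace SemiGraph

universe u

variable {G : SemiGraph.{u}}

/-! ### § 0. Two lemmas on connected components of a sub-semi-graph ([SemiAnbd] §1 pp. 11–12) -/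

/-- **Two vertices of a sub-semi-graph joined by one of its edges lie in the same connected component** of
(the barycentric subdivision of) the sub-semi-graph: the walk vertex — branch — edge — branch — vertex.
[cite: MochizukiSemiAnbd2006, §1 p.12] -/
theorem Subgraph.reachable_inl_inl_of_edge (K : G.Subgraph) {b₁ b₂ : G.Branch}
    (he : G.edgeOf b₁ = G.edgeOf b₂) (hK : G.edgeOf b₁ ∈ K.edges) {v w : G.Vertex} (hv : v ∈ K.verts)
    (hw : w ∈ K.verts) (h₁ : G.abuts b₁ = some v) (h₂ : G.abuts b₂ = some w) :
    K.toSemiGraph.subdivision.Reachable (Sum.inl ⟨v, hv⟩) (Sum.inl ⟨w, hw⟩) := by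
  have hK₂ : G.edgeOf b₂ ∈ K.edges := he ▸ hK
  have a₁ : K.toSemiGraph.abuts ⟨b₁, hK⟩ = some ⟨v, hv⟩ :=
    (Subgraph.abuts_mk_eq_some_iff K hK ⟨v, hv⟩).mpr h₁
  have a₂ : K.toSemiGraph.abuts ⟨b₂, hK₂⟩ = some ⟨w, hw⟩ :=
    (Subgraph.abuts_mk_eq_some_iff K hK₂ ⟨w, hw⟩).mpr h₂
  have hedge : K.toSemiGraph.edgeOf ⟨b₁, hK⟩ = K.toSemiGraph.edgeOf ⟨b₂, hK₂⟩ := Subtype.ext he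
  refine (K.toSemiGraph.subdivision_reachable_branch_vertex a₁).symm.trans ?_
  refine (K.toSemiGraph.subdivision_reachable_edge_branch ⟨b₁, hK⟩).symm.trans ?_
  rw [hedge]
  exact (K.toSemiGraph.subdivision_reachable_edge_branch ⟨b₂, hK₂⟩).trans
    (K.toSemiGraph.subdivision_reachable_branch_vertex a₂)

/-- **A vertex predicate balanced along the edges of a sub-semi-graph is constant on its connected
components**: if for every branch `b` of an edge of `K` abutting to a vertex `v` the truth of `P v` is the value
`PE` of that edge, then two vertices of `K` in the same connected component of `K` satisfy `P` simultaneously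
(induction along a walk of the barycentric subdivision). [cite: MochizukiSemiAnbd2006, §1 p.12] -/
theorem Subgraph.reachable_inl_inl_invariant (K : G.Subgraph) (P : G.Vertex → Prop) (PE : G.Edge → Prop)
    (hc : ∀ (b : G.Branch) (v : G.Vertex), G.edgeOf b ∈ K.edges → G.abuts b = some v → (PE (G.edgeOf b) ↔ P v))
    {v w : G.Vertex} (hv : v ∈ K.verts) (hw : w ∈ K.verts)
    (h : K.toSemiGraph.subdivision.Reachable (Sum.inl ⟨v, hv⟩) (Sum.inl ⟨w, hw⟩)) : P v ↔ P w := by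
  -- the invariant on all nodes of the subdivision of `K`
  let N : K.toSemiGraph.Node → Prop :=
    Sum.elim (fun x => P x.1) (Sum.elim (fun e => PE e.1) (fun b => PE (G.edgeOf b.1)))
  have hrel : ∀ x y : K.toSemiGraph.Node, K.toSemiGraph.NodeRel x y → (N x ↔ N y) := by
    intro x y hxy
    cases hxy with
    | edge_branch b => exact Iff.rfl
    | branch_vertex b u hb =>
      have hb' : G.abuts b.1 = some u.1 := (Subgraph.abuts_mk_eq_some_iff K b.2 u).mp hb
      exact hc b.1 u.1 b.2 hb'
  have hadj : ∀ x y : K.toSemiGraph.Node, K.toSemiGraph.subdivision.Adj x y → (N x ↔ N y) := by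
    intro x y hxy
    rcases (K.toSemiGraph.subdivision_adj_iff).mp hxy with h | h
    · exact hrel x y h
    · exact (hrel y x h).symm
  have hwalk : ∀ (x y : K.toSemiGraph.Node), K.toSemiGraph.subdivision.Walk x y → (N x ↔ N y) := by
    intro x y p
    induction p with
    | nil => exact Iff.rfl
    | cons hxy _ ih => exact (hadj _ _ hxy).trans ih
  obtain ⟨p⟩ := h
  exact hwalk _ _ p

end SemiGraph

end Literature.AnabelianGeometry.SemiGraphs

namespace Literature.IUT.HodgeTheaters

namespace StableCurveTemperedData

open CategoryTheory Literature.AnabelianGeometry.SemiGraphs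
open scoped Pointwise

universe u

/-! ### § 1. `_degenerate`: the record is inhabited over every tower of every datum -/

/-- **`Prop24Tower.CoveringLevelGraphs` is inhabited over EVERY tower `T` of EVERY datum** by the `_degenerate`
realisation: base and levels the one-vertex edgeless semi-graph, identity projections, trivial deck action,
`ℍ` = everything.  DEGENERATE: records only that the type is inhabited (never to be cited for non-vacuity of
the laws). ([IUTchI] Prop 2.4(i) p.50) [claim: Mochizuki2012, status: disputed] -/
theorem Prop24Tower.CoveringLevelGraphs.nonempty_degenerate {D : StableCurveTemperedData.{u}}
    (T : D.Prop24Tower) : Nonempty T.CoveringLevelGraphs :=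
  ⟨{ base :=
      { Vertex := PUnit.{u + 1}
        Edge := PEmpty.{u + 1}
        Branch := PEmpty.{u + 1}
        edgeOf := fun b => nomatch b
        abuts := fun b => nomatch b
        two_branches := fun e => nomatch e }
     H := ⟨Set.univ, Set.univ⟩
     graph := fun _ =>
      { Vertex := PUnit.{u + 1}
        Edge := PEmpty.{u + 1}
        Branch := PEmpty.{u + 1}
        edgeOf := fun b => nomatch b
        abuts := fun b => nomatch b
        two_branches := fun e => nomatch e }
     proj := fun _ => 𝟙 _
     act := fun _ => 1
     act_over := fun _ _ => rfl
     ctr := fun _ => PUnit.unit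
     ctr_mem := fun _ => Set.mem_univ _
     vtxCusp := fun _ _ => PUnit.unit }⟩

/-! ### § 2. `_model` at the toy: the Schreier coset coverings of the bouquet -/

namespace FreeModel

/-- **The semi-graph-covering realisation over the toy, for a normal level family** (engine of
`CoveringLevelGraphs.exists_model_free`, stated for any family `J_i ⊴ F₂` cutting out the levels and any second
loop label `x₁`): base = bouquet (one vertex, two loops labelled `false ↦ x₀`, `true ↦ x₁`), `ℍ` = the loop `false`, level `i` = the
Schreier coset graph of `F₂ ⧸ J_i` for the letters `(x₀, x₁)` (vertex set `F₂ ⧸ J_i`, edge set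
`(F₂ ⧸ J_i) × Bool`, the `s`-edge at `v` joining `v` to `v·x_s`), `p_i` the covering projection, `F₂` acting by
left translation OVER `p_i`, `c_i = 1·J_i`; and for the REALISED level data: B4 (three rows), B1 (a)(b)(c),
and vacuously (no cusps) `LevelIncidence`, `LevelTarget`. ([IUTchI] Prop 2.4(i) p.50) [claim: Mochizuki2012, status: disputed] -/
theorem CoveringLevelGraphs.exists_schreier (T : toy.Prop24Tower) (J : T.I → Subgroup F2)
    [hJn : ∀ i, (J i).Normal] (hJ : ∀ i (d : toy.DeltaTp), d ∈ toy.levelTp (T.Jhat i) ↔ (d : F2) ∈ J i)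
    (x1 : F2) :
    ∃ C : T.CoveringLevelGraphs,
      (∀ i, (C.graph i).Vertex = (F2 ⧸ J i)) ∧ (∀ i, (C.graph i).Edge = ((F2 ⧸ J i) × Bool)) ∧
      C.toLevelData.CompsDisjoint ∧ C.toLevelData.CompsInvariant ∧ C.toLevelData.IsBlock ∧
      C.toLevelData.LevelActsTrivially ∧ C.toLevelData.DeltaHStabilizes ∧ C.toLevelData.StabLeDeltaHLevel ∧
      C.toLevelData.LevelIncidence ∧ T.LevelTarget := by
  classical
  -- the realisation
  let C : T.CoveringLevelGraphs :=
    { base :=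
        { Vertex := PUnit
          Edge := Bool
          Branch := Bool × Bool
          edgeOf := fun b => b.1
          abuts := fun _ => some PUnit.unit
          two_branches := fun e => ⟨(e, false), (e, true), by simp, rfl, rfl, fun b hb => by
            subst hb; rcases b with ⟨s, _ | _⟩ <;> simp⟩ }
      H := ⟨Set.univ, {false}⟩
      graph := fun i =>
        { Vertex := F2 ⧸ J i
          Edge := (F2 ⧸ J i) × Bool
          Branch := (F2 ⧸ J i) × Bool × Bool
          edgeOf := fun b => (b.1, b.2.1)
          abuts := fun b => some (cond b.2.2 (b.1 * (QuotientGroup.mk (cond b.2.1 x1 x0) : F2 ⧸ J i)) b.1)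
          two_branches := fun e => ⟨(e.1, e.2, false), (e.1, e.2, true), by simp, rfl, rfl, fun b hb => by
            subst hb; rcases b with ⟨q, s, _ | _⟩ <;> simp⟩ }
      proj := fun i =>
        { vertexMap := fun _ => PUnit.unit
          edgeMap := fun e => e.2
          branchMap := fun b => b.2
          edgeOf_branchMap := fun _ => rfl
          branchMap_injOn := fun b₁ b₂ he hb => Prod.ext (Prod.mk.inj he).1 hb
          abuts_branchMap := fun _ _ _ => rfl }
      act := fun i =>
        { toFun := fun t =>
            { hom :=
                { vertexMap := fun v => (QuotientGroup.mk t : F2 ⧸ J i) * v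
                  edgeMap := fun e => ((QuotientGroup.mk t : F2 ⧸ J i) * e.1, e.2)
                  branchMap := fun b => ((QuotientGroup.mk t : F2 ⧸ J i) * b.1, b.2)
                  edgeOf_branchMap := fun _ => rfl
                  branchMap_injOn := fun b₁ b₂ _ hb => by
                    obtain ⟨h1, h2⟩ := Prod.mk.inj hb
                    exact Prod.ext (mul_left_cancel h1) h2
                  abuts_branchMap := fun b v h => by
                    cases h
                    rcases b with ⟨q, s, _ | _⟩ <;> simp [mul_assoc] }
              inv :=
                { vertexMap := fun v => (QuotientGroup.mk t : F2 ⧸ J i)⁻¹ * v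
                  edgeMap := fun e => ((QuotientGroup.mk t : F2 ⧸ J i)⁻¹ * e.1, e.2)
                  branchMap := fun b => ((QuotientGroup.mk t : F2 ⧸ J i)⁻¹ * b.1, b.2)
                  edgeOf_branchMap := fun _ => rfl
                  branchMap_injOn := fun b₁ b₂ _ hb => by
                    obtain ⟨h1, h2⟩ := Prod.mk.inj hb
                    exact Prod.ext (mul_left_cancel h1) h2
                  abuts_branchMap := fun b v h => by
                    cases h
                    rcases b with ⟨q, s, _ | _⟩ <;> simp [mul_assoc] }
              hom_inv_id := by
                refine SemiGraph.hom_ext _ _ ?_ ?_ ?_ <;> funext x <;> simp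
              inv_hom_id := by
                refine SemiGraph.hom_ext _ _ ?_ ?_ ?_ <;> funext x <;> simp }
          map_one' := by
            refine Aut.ext ?_
            refine SemiGraph.hom_ext _ _ ?_ ?_ ?_ <;> funext x <;> simp <;> rfl
          map_mul' := fun t t' => by
            refine Aut.ext ?_
            refine SemiGraph.hom_ext _ _ ?_ ?_ ?_ <;> funext x <;> simp [Aut.Aut_mul_def, mul_assoc] }
      act_over := fun _ _ => rfl
      ctr := fun i => (1 : F2 ⧸ J i)
      ctr_mem := fun _ => Set.mem_univ _
      vtxCusp := fun _ x => nomatch x }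

  -- bookkeeping on the realisation
  have hV : ∀ i (u : F2 ⧸ J i), u ∈ (C.preimageH i).verts := fun _ _ => Set.mem_univ _
  have hE : ∀ i (q : F2 ⧸ J i), (C.graph i).edgeOf (q, false, false) ∈ (C.preimageH i).edges :=
    fun _ _ => Set.mem_singleton false
  -- one `x₀`-edge of `p_i⁻¹(ℍ)`: `v — v·x₀`
  have step : ∀ i (v : F2 ⧸ J i),
      (C.preimageH i).toSemiGraph.subdivision.Reachable (Sum.inl ⟨v, hV i v⟩)
        (Sum.inl ⟨v * (QuotientGroup.mk x0 : F2 ⧸ J i), hV i _⟩) :=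
    fun i v => SemiGraph.Subgraph.reachable_inl_inl_of_edge (C.preimageH i)
      (b₁ := (v, false, false)) (b₂ := (v, false, true)) rfl (hE i v) (hV i v) (hV i _) rfl rfl
  have reach_congr : ∀ i (a : (C.preimageH i).toSemiGraph.Node) (v w : F2 ⧸ J i), v = w →
      (C.preimageH i).toSemiGraph.subdivision.Reachable a (Sum.inl ⟨v, hV i v⟩) →
      (C.preimageH i).toSemiGraph.subdivision.Reachable a (Sum.inl ⟨w, hV i w⟩) := by
    rintro i a v w rfl h; exact h
  -- `ℍ̃_i` COMPUTED: the `x₀`-Schreier class of the base vertex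
  have hmem : ∀ i (u : F2 ⧸ J i),
      u ∈ C.toLevelData.compH i ↔ ∃ k : ℤ, u = (QuotientGroup.mk x0 : F2 ⧸ J i) ^ k := by
    intro i u
    constructor
    · rintro ⟨hu, hr⟩
      have key := SemiGraph.Subgraph.reachable_inl_inl_invariant (C.preimageH i)
        (fun w => ∃ k : ℤ, w = (QuotientGroup.mk x0 : F2 ⧸ J i) ^ k)
        (fun e => ∃ k : ℤ, e.1 = (QuotientGroup.mk x0 : F2 ⧸ J i) ^ k) ?_ (C.ctr_mem i) hu hr
      · exact key.mp ⟨0, by simp [C]⟩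
      · rintro ⟨q, s, c⟩ w hs hb
        have hs' : s = false := hs
        subst hs'
        have hw : some (cond c (q * (QuotientGroup.mk x0 : F2 ⧸ J i)) q) = some w := hb
        cases c
        · cases hw
          exact Iff.rfl
        · cases hw
          show (∃ k : ℤ, q = (QuotientGroup.mk x0 : F2 ⧸ J i) ^ k) ↔
            (∃ k : ℤ, q * (QuotientGroup.mk x0 : F2 ⧸ J i) = (QuotientGroup.mk x0 : F2 ⧸ J i) ^ k)
          constructor
          · rintro ⟨k, rfl⟩
            exact ⟨k + 1, (zpow_add_one _ k).symm⟩
          · rintro ⟨k, hk⟩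
            refine ⟨k - 1, ?_⟩
            rw [zpow_sub_one, ← hk, mul_inv_cancel_right]
    · rintro ⟨k, rfl⟩
      change ∃ hu, (C.preimageH i).toSemiGraph.subdivision.Reachable (Sum.inl ⟨1, hV i 1⟩) (Sum.inl ⟨_, hu⟩)
      refine ⟨hV i _, ?_⟩
      induction k using Int.induction_on with
      | zero => exact reach_congr i _ _ _ (zpow_zero _).symm (SimpleGraph.Reachable.refl _)
      | succ k ih =>
        exact reach_congr i _ _ _ (zpow_add_one _ _).symm (ih.trans (step i _))
      | pred k ih =>
        refine ih.trans ?_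
        have h2 := step i ((QuotientGroup.mk x0 : F2 ⧸ J i) ^ (-(k : ℤ) - 1))
        exact (reach_congr i _ _ _ (by rw [zpow_sub_one, inv_mul_cancel_right]) h2).symm
  refine ⟨C, fun _ => rfl, fun _ => rfl, C.toLevelData_compsDisjoint, C.toLevelData_compsInvariant,
    C.toLevelData_isBlock, ?_, ?_, ?_, ?_, ?_⟩
  · -- B1 (a): `J_i` acts trivially on `F₂ ⧸ J_i`
    refine C.toLevelData_levelActsTrivially fun i j hj => ?_
    have h1 : (QuotientGroup.mk (j : F2) : F2 ⧸ J i) = 1 :=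
      (QuotientGroup.eq_one_iff (j : F2)).mpr ((hJ i j).mp hj)
    refine Aut.ext ?_
    refine SemiGraph.hom_ext _ _ ?_ ?_ ?_ <;> funext x
    · show (QuotientGroup.mk (j : F2) : F2 ⧸ J i) * x = x
      rw [h1, one_mul]
    · show ((QuotientGroup.mk (j : F2) : F2 ⧸ J i) * x.1, x.2) = x
      rw [h1, one_mul]
    · show ((QuotientGroup.mk (j : F2) : F2 ⧸ J i) * x.1, x.2) = x
      rw [h1, one_mul]
  · -- B1 (b): `⟨x₀⟩` stabilises `ℍ̃_i`
    intro i k hk v hv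
    obtain ⟨m, rfl⟩ := (hmem i v).mp hv
    obtain ⟨n, hn⟩ := Subgroup.mem_zpowers_iff.mp ((mem_deltaTpH_iff k).mp hk)
    refine (hmem i _).mpr ⟨n + m, ?_⟩
    show (QuotientGroup.mk (k : F2) : F2 ⧸ J i) * (QuotientGroup.mk x0 : F2 ⧸ J i) ^ m = _
    rw [← hn, QuotientGroup.mk_zpow, zpow_add]
  · -- B1 (c): the stabiliser of `ℍ̃_i` in `F₂` lies in `⟨x₀⟩·J_i`
    intro i γ hγ
    have h1 : (1 : F2 ⧸ J i) ∈ C.toLevelData.compH i := (hmem i 1).mpr ⟨0, (zpow_zero _).symm⟩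
    obtain ⟨m, hm⟩ := (hmem i _).mp (hγ (1 : F2 ⧸ J i) h1)
    have hm' : (QuotientGroup.mk (γ : F2) : F2 ⧸ J i) = QuotientGroup.mk (x0 ^ m) := by
      rw [QuotientGroup.mk_zpow, ← hm]
      exact (mul_one _).symm
    have hmem' : (x0 ^ m)⁻¹ * (γ : F2) ∈ J i := QuotientGroup.eq.mp hm'.symm
    exact ⟨⟨x0 ^ m, mem_deltaTp _⟩, (mem_deltaTpH_iff _).mpr ⟨m, rfl⟩, (hJ i _).mpr hmem'⟩
  · -- `LevelIncidence`: no cusps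
    intro i x
    exact nomatch x
  · -- `LevelTarget`: no cusps
    intro i x
    exact nomatch x

/-- **NV-L5 `Prop24Tower.CoveringLevelGraphs`, `_model` at the toy.**  For EVERY tower `T` of abc-iut-L5-d4's toy
datum with normal levels, the record `CoveringLevelGraphs T` is inhabited by the GENUINE semi-graph coverings
of the toy: base the bouquet `B₂` (one vertex, loops `x₀ ↦ false`, `x₁ ↦ true`), `ℍ` the `x₀`-loop, level `i` the
Schreier coset graph on `F₂ ⧸ J_i` (`J_i := ι⁻¹(Ĵ_i)`) = the finite étale covering of `B₂` determined by `J_i`,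
`p_i` its projection, `Π^tp_X = F₂` acting by left translation = deck transformations, `c_i = J_i`; and the level
data it REALISES (abc-iut-w4-d076's `CoveringLevelGraphs.toLevelData`) satisfies B4 (`CompsDisjoint`,
`CompsInvariant`, `IsBlock` — instances of the general theorems), B1 (`LevelActsTrivially`, `DeltaHStabilizes`,
`StabLeDeltaHLevel`: `Stab_{F₂}(ℍ̃_i) = ⟨x₀⟩·J_i`, with `ℍ̃_i` = the `x₀`-Schreier class of `J_i` COMPUTED from the
reachability definition) and, VACUOUSLY (no cusps), `LevelIncidence` and `LevelTarget`; its vertex sets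
`F₂ ⧸ J_i` are those of abc-iut-w4-d063's `SubgraphLevelData.exists_model_free`.
([IUTchI] Prop 2.4(i) p.50) [claim: Mochizuki2012, status: disputed] -/
theorem CoveringLevelGraphs.exists_model_free (T : toy.Prop24Tower) (hN : T.LevelsNormal) :
    ∃ C : T.CoveringLevelGraphs,
      (∀ i, (C.graph i).Vertex = (F2 ⧸ (T.Jhat i).comap toy.ιX)) ∧
      (∀ i, (C.graph i).Edge = ((F2 ⧸ (T.Jhat i).comap toy.ιX) × Bool)) ∧
      C.toLevelData.CompsDisjoint ∧ C.toLevelData.CompsInvariant ∧ C.toLevelData.IsBlock ∧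
      C.toLevelData.LevelActsTrivially ∧ C.toLevelData.DeltaHStabilizes ∧ C.toLevelData.StabLeDeltaHLevel ∧
      C.toLevelData.LevelIncidence ∧ T.LevelTarget := by
  haveI : ∀ i, ((T.Jhat i).comap toy.ιX).Normal := comap_normal_of_levelsNormal T hN
  exact CoveringLevelGraphs.exists_schreier T (fun i => (T.Jhat i).comap toy.ιX) (fun _ _ => Iff.rfl)
    (show F2 from (FreeGroup.of (1 : Fin 2) : FreeGroup (Fin 2)))

/-- `CoveringLevelGraphs T` is inhabited, NON-degenerately, over every normal-level tower of the toy.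
([IUTchI] Prop 2.4(i) p.50) [claim: Mochizuki2012, status: disputed] -/
theorem CoveringLevelGraphs.nonempty_model_free (T : toy.Prop24Tower) (hN : T.LevelsNormal) :
    Nonempty T.CoveringLevelGraphs := by
  obtain ⟨C, -⟩ := CoveringLevelGraphs.exists_model_free T hN
  exact ⟨C⟩

/-! ### § 3. Capstone: the tower of all finite-index normal subgroups carries the realisation -/

/-- **Joint satisfiability at the toy: the Prop. 2.4 (i) tower laws together with the SEMI-GRAPH-COVERING
realisation of the Cor. 2.3-at-levels data.**  abc-iut-w4-d012's tower of all finite-index normal subgroups of `F₂`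
(`exists_prop24Tower_model`: ten (i)-laws) carries the Schreier coverings of `CoveringLevelGraphs.exists_model_free`
with all named B1/B4 rows of the realised level data, and — its levels being open — `LevelCommTerminal`
(`levelCommTerminal_free_of_levelsOpen`). ([IUTchI] Prop 2.4(i) p.50) [claim: Mochizuki2012, status: disputed] -/
theorem exists_prop24Tower_coveringLevelGraphs_model :
    ∃ (T : toy.Prop24Tower) (C : T.CoveringLevelGraphs),
      (T.LevelsClosed ∧ T.LevelsInDelta ∧ T.LevelsNormal ∧ T.LevelsOpen ∧ T.LevelsCofinal ∧
        T.Translate ∧ T.DetectsTempered ∧ T.SpecializationAb ∧ T.LevelsDetect ∧ T.Prop21Levels) ∧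
      (∀ i, (C.graph i).Vertex = (F2 ⧸ (T.Jhat i).comap toy.ιX)) ∧
      C.toLevelData.CompsDisjoint ∧ C.toLevelData.CompsInvariant ∧ C.toLevelData.IsBlock ∧
      C.toLevelData.LevelActsTrivially ∧ C.toLevelData.DeltaHStabilizes ∧ C.toLevelData.StabLeDeltaHLevel ∧
      C.toLevelData.LevelIncidence ∧ T.LevelTarget ∧
      Prop24Tower.SubgraphLevelData.LevelCommTerminal (T := T) := by
  obtain ⟨T, hC, hΔ, hN, hO, hcof, htr, hdet, hab, hLD, h21⟩ := exists_prop24Tower_model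
  obtain ⟨C, hV, -, hdisj, hinv, hblk, htriv, hH, hstab, hinc, htgt⟩ :=
    CoveringLevelGraphs.exists_model_free T hN
  exact ⟨T, C, ⟨hC, hΔ, hN, hO, hcof, htr, hdet, hab, hLD, h21⟩, hV, hdisj, hinv, hblk, htriv, hH, hstab,
    hinc, htgt, levelCommTerminal_free_of_levelsOpen T hO⟩

end FreeModel

end StableCurveTemperedData

end Literature.IUT.HodgeTheaters
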